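import Mathlib

/-!
# Crux `MonotoneSuffices` (stmt-PneNP-18026), the GREEDY general detector — part 3:
# independence of disjoint coordinate sets under the uniform measure

On the uniform cube `{0,1}^α`, an event depending only on the coordinates in `F` and an event depending only
on the coordinates outside `F` are independent:

* `card_filter_and_mul_card` — `#{x : P x ∧ Q x} · 2^{|α|} = #{x : P x} · #{x : Q x}` (the bijection
  `(w, x) ↦ (merge_F w x, merge_F x w)` of the square of the cube);
* `card_filter_exists_and_le` — consequently, for a family of pairwise EXCLUSIVE inside-events `P i` and
  outside-events `Q i` each of measure `≤ b/2^{|α|}`: `#{x : ∃ i ∈ s, P i x ∧ Q i x} ≤ b`.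

In the greedy detector the inside-event is "the run of the trial ends with the picks `T`" (it reads only edges
among the candidates) and the outside-event is a tail event for the common neighbours of `T` among the
non-candidates. Pure finite combinatorics.
-/

set_option linter.dupNamespace false -- `Summit.PneNP.PneNP.…`: summit = sub-problem name (D-0017 single-conjunct layout)

namespace Summit.PneNP.PneNP.Theorems.MonotoneSuffices.Greedy

open Finset

variable {α : Type*} [Fintype α] [DecidableEq α]

/-! ### Merging along a coordinate set -/

omit [Fintype α] in
/-- Merging is involutive on pairs: `merge (merge w x) (merge x w) = w`. [folklore] -/
theorem merge_merge (F : Finset α) (w x : α → Bool) :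
    (fun a => if a ∈ F then (if a ∈ F then w a else x a) else (if a ∈ F then x a else w a)) = w := by
  funext a; by_cases h : a ∈ F <;> simp [h]

/-- **Independence of disjoint coordinate sets.** If `P` depends only on the coordinates in `F` and `Q` only
on the coordinates outside `F`, then `#{x : P x ∧ Q x} · 2^{|α|} = #{x : P x} · #{x : Q x}`. [folklore] -/
theorem card_filter_and_mul_card (F : Finset α) (P Q : (α → Bool) → Prop) [DecidablePred P] [DecidablePred Q]
    (hP : ∀ x x' : α → Bool, (∀ a ∈ F, x a = x' a) → (P x ↔ P x'))
    (hQ : ∀ x x' : α → Bool, (∀ a ∉ F, x a = x' a) → (Q x ↔ Q x')) :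
    #((univ : Finset (α → Bool)).filter fun x => P x ∧ Q x) * Fintype.card (α → Bool) =
      #((univ : Finset (α → Bool)).filter P) * #((univ : Finset (α → Bool)).filter Q) := by
  classical
  -- both sides count pairs
  have hL : #((univ : Finset (α → Bool)).filter fun x => P x ∧ Q x) * Fintype.card (α → Bool) =
      #((univ : Finset ((α → Bool) × (α → Bool))).filter fun p => P p.1 ∧ Q p.1) := by
    rw [← card_univ, ← card_product]
    have : ((univ : Finset ((α → Bool) × (α → Bool))).filter fun p => P p.1 ∧ Q p.1) =
        ((univ : Finset (α → Bool)).filter fun x => P x ∧ Q x) ×ˢ (univ : Finset (α → Bool)) := by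
      ext p; simp
    rw [this]
  have hR : #((univ : Finset (α → Bool)).filter P) * #((univ : Finset (α → Bool)).filter Q) =
      #((univ : Finset ((α → Bool) × (α → Bool))).filter fun p => P p.1 ∧ Q p.2) := by
    rw [← card_product]
    have : ((univ : Finset ((α → Bool) × (α → Bool))).filter fun p => P p.1 ∧ Q p.2) =
        ((univ : Finset (α → Bool)).filter P) ×ˢ ((univ : Finset (α → Bool)).filter Q) := by
      ext p; simp
    rw [this]
  rw [hL, hR]
  -- the bijection `(w, x) ↦ (merge w x, merge x w)` from the right set to the left set
  symm
  refine card_bij (fun p _ => ((fun a => if a ∈ F then p.1 a else p.2 a), (fun a => if a ∈ F then p.2 a else p.1 a)))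
    (fun p hp => ?_) (fun p₁ _ p₂ _ h => ?_) (fun q hq => ?_)
  · rw [mem_filter] at hp ⊢
    refine ⟨mem_univ _, ?_, ?_⟩
    · exact (hP _ _ (fun a ha => by simp [ha])).2 hp.2.1
    · exact (hQ _ _ (fun a ha => by simp [ha])).2 hp.2.2
  · obtain ⟨h1, h2⟩ := Prod.mk.inj h
    refine Prod.ext (funext fun a => ?_) (funext fun a => ?_)
    · have e1 := congrFun h1 a
      have e2 := congrFun h2 a
      by_cases ha : a ∈ F <;> simp [ha] at e1 e2 <;> assumption
    · have e1 := congrFun h1 a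
      have e2 := congrFun h2 a
      by_cases ha : a ∈ F <;> simp [ha] at e1 e2 <;> assumption
  · refine ⟨((fun a => if a ∈ F then q.1 a else q.2 a), (fun a => if a ∈ F then q.2 a else q.1 a)), ?_, ?_⟩
    · rw [mem_filter] at hq ⊢
      refine ⟨mem_univ _, ?_, ?_⟩
      · exact (hP _ _ (fun a ha => by simp [ha])).2 hq.2.1
      · refine (hQ _ _ (fun a ha => ?_)).2 hq.2.2
        simp [ha]
    · exact Prod.ext (merge_merge F q.1 q.2) (merge_merge F q.2 q.1)

/-- **Exclusive inside-events against small outside-events.** If the events `P i` (`i ∈ s`) depend only on the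
coordinates in `F` and are pairwise exclusive, and each `Q i` depends only on the coordinates outside `F` and
has at most `b` points, then `#{x : ∃ i ∈ s, P i x ∧ Q i x} ≤ b`. [folklore] -/
theorem card_filter_exists_and_le {ι : Type*} (s : Finset ι) (F : Finset α) (P Q : ι → (α → Bool) → Prop)
    [∀ i, DecidablePred (P i)] [∀ i, DecidablePred (Q i)] (b : ℕ)
    (hP : ∀ i ∈ s, ∀ x x' : α → Bool, (∀ a ∈ F, x a = x' a) → (P i x ↔ P i x'))
    (hQ : ∀ i ∈ s, ∀ x x' : α → Bool, (∀ a ∉ F, x a = x' a) → (Q i x ↔ Q i x'))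
    (hdisj : ∀ i ∈ s, ∀ j ∈ s, ∀ x, P i x → P j x → i = j)
    (hb : ∀ i ∈ s, #((univ : Finset (α → Bool)).filter (Q i)) ≤ b) :
    #((univ : Finset (α → Bool)).filter fun x => ∃ i ∈ s, P i x ∧ Q i x) ≤ b := by
  classical
  have hcube : 0 < Fintype.card (α → Bool) := Fintype.card_pos
  -- union bound over `i`, then independence termwise
  have hunion : ((univ : Finset (α → Bool)).filter fun x => ∃ i ∈ s, P i x ∧ Q i x) ⊆
      s.biUnion fun i => (univ : Finset (α → Bool)).filter fun x => P i x ∧ Q i x := by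
    intro x hx
    simp only [mem_filter, mem_univ, true_and, mem_biUnion] at hx ⊢
    exact hx
  have h1 : #((univ : Finset (α → Bool)).filter fun x => ∃ i ∈ s, P i x ∧ Q i x) * Fintype.card (α → Bool) ≤
      ∑ i ∈ s, #((univ : Finset (α → Bool)).filter (P i)) * b := by
    calc #((univ : Finset (α → Bool)).filter fun x => ∃ i ∈ s, P i x ∧ Q i x) * Fintype.card (α → Bool)
        ≤ (∑ i ∈ s, #((univ : Finset (α → Bool)).filter fun x => P i x ∧ Q i x)) * Fintype.card (α → Bool) :=
          Nat.mul_le_mul_right _ ((card_le_card hunion).trans card_biUnion_le)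
      _ = ∑ i ∈ s, #((univ : Finset (α → Bool)).filter (P i)) * #((univ : Finset (α → Bool)).filter (Q i)) := by
          rw [sum_mul]
          exact sum_congr rfl fun i hi => card_filter_and_mul_card F (P i) (Q i) (hP i hi) (hQ i hi)
      _ ≤ ∑ i ∈ s, #((univ : Finset (α → Bool)).filter (P i)) * b :=
          sum_le_sum fun i hi => Nat.mul_le_mul_left _ (hb i hi)
  -- the exclusive events have total mass at most the cube
  have h2 : ∑ i ∈ s, #((univ : Finset (α → Bool)).filter (P i)) ≤ Fintype.card (α → Bool) := by
    rw [← card_univ, ← card_biUnion]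
    · exact card_le_card (biUnion_subset.2 fun i _ => filter_subset _ _)
    · intro i hi j hj hij
      rw [Function.onFun, disjoint_filter]
      exact fun x _ hPi hPj => hij (hdisj i hi j hj x hPi hPj)
  have h3 : #((univ : Finset (α → Bool)).filter fun x => ∃ i ∈ s, P i x ∧ Q i x) * Fintype.card (α → Bool) ≤
      b * Fintype.card (α → Bool) := by
    calc _ ≤ ∑ i ∈ s, #((univ : Finset (α → Bool)).filter (P i)) * b := h1
      _ = (∑ i ∈ s, #((univ : Finset (α → Bool)).filter (P i))) * b := by rw [sum_mul]
      _ ≤ Fintype.card (α → Bool) * b := Nat.mul_le_mul_right _ h2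
      _ = b * Fintype.card (α → Bool) := by ring
  exact Nat.le_of_mul_le_mul_right h3 hcube

end Summit.PneNP.PneNP.Theorems.MonotoneSuffices.Greedy

namespace Summit.PneNP.PneNP.Theorems.MonotoneSuffices.Greedy

open Finset

/-- Registered sub-goal `greedy_split` of stmt-PneNP-18026 (greedy detector, part 3): independence of disjoint
coordinate sets under the uniform measure, exported verbatim. [folklore] -/
theorem greedy_split :
    ∀ {α : Type*} [Fintype α] [DecidableEq α] (F : Finset α) (P Q : (α → Bool) → Prop) [DecidablePred P] [DecidablePred Q], (∀ x x' : α → Bool, (∀ a ∈ F, x a = x' a) → (P x ↔ P x')) → (∀ x x' : α → Bool, (∀ a ∉ F, x a = x' a) → (Q x ↔ Q x')) → #((Finset.univ : Finset (α → Bool)).filter fun x => P x ∧ Q x) * Fintype.card (α → Bool) = #((Finset.univ : Finset (α → Bool)).filter P) * #((Finset.univ : Finset (α → Bool)).filter Q) :=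
  fun F P Q _ _ hP hQ => card_filter_and_mul_card F P Q hP hQ

end Summit.PneNP.PneNP.Theorems.MonotoneSuffices.Greedy
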